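import Mathlib
import Summits.ValiantsHypothesis.ValiantsHypothesis.Theses.ValuativeGCT
import Summits.ValiantsHypothesis.ValiantsHypothesis.Theses.GCTMult
import Summits.ValiantsHypothesis.ValiantsHypothesis.Theorems.ValuativeGCTValuativeBound
import Summits.ValiantsHypothesis.ValiantsHypothesis.Theorems.ValuativeGCTNoValuativeFlipReductions
import Summits.ValiantsHypothesis.ValiantsHypothesis.Theorems.ValuativeGCTValuativeFlipKroneckerCensus
import Literature.Computability.Complexity.OccurrenceObstructionsDischarge
import Literature.NumberTheory.DiophantineGeometry.SchurWeylPlethysmOrbitWeightsProofs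

/-!
# `NoValuativeFlip` (stmt-ValiantsHypothesis-12629): the occurrence shadow holds, and the Kronecker shadow

Route `ValuativeGCT`, support item `NoValuativeFlip` (the valuative no-go: from some polynomial
padding `m ≥ n ^ c₀` on, for every singular-space truncation `(U, r)` and every `(δ, λ)`,
`mult_λ* ℂ[Δ(X₀₀^(m-n) per_n)] ≤ dim T_U(λ)`). The item itself is the open multiplicity no-go
(it follows from `GCTMult.GctNoMultBarrier`, stmt-ValiantsHypothesis-0890, and its negation gives
`DcPerSuperpolynomial ℂ`; files `ValuativeGCTNoValuativeFlipReductions/Unconditional`). This file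
adds two unconditional facts about its position.

* §1 **The occurrence shadow of the item is a theorem** (exponent `25`): for `0 < n`,
  `n ^ 25 ≤ m` and every `(U, r, δ, λ)`, if `λ*` OCCURS in `ℂ[Δ(X₀₀^(m-n) per_n)]`
  (`0 < mult_pp(λ*)`) then the valuative truncation `T_U(λ)` is NONZERO (`0 < dim T_U(λ)`):
  Bürgisser–Ikenmeyer–Panova's no-occurrence-obstruction theorem, discharged in the tree for the
  fresh-variable padding (`Literature.Computability.Complexity.no_occurrence_obstructions_holds`,
  J. AMS 32 (2019) Thm. 1.4 with `M = n + 1`), moves the occurrence to `ℂ[Δ(det_m)]`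
  (`orbitMultiplicity_det_pos_of_paddedPer_pos`), and the route's valuative bound
  `K_m(λ*) ≤ dim T_U(λ)` (`ValuativeBound_proof`, stmt-12625) moves it into every truncation
  (`finrank_truncation_pos_of_orbitMultiplicity_paddedPer_pos`, packaged as
  `noValuativeFlip_occurrenceShadow`). So a valuative flip at polynomial padding `m ≥ n ^ 25` is
  never a VANISHING of the truncation — it is a proper multiplicity comparison
  `0 < dim T_U(λ) < mult_pp(λ*)` — and the item is equivalent to its restriction to the weights
  occurring in BOTH coordinate rings (`noValuativeFlip_iff_onCommonSupport`).
* §2 **The Kronecker shadow**: the item implies that beyond some polynomial padding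
  `mult_pp(λ*) ≤ g(λ, m×δ, m×δ)` for every `λ ⊢ mδ` with at most `m²` parts
  (`orbitMultiplicity_paddedPer_le_kroneckerCoeff_of_noValuativeFlip`: the `U`-free consequence
  `mult_pp ≤ dim T₀` of the first seat composed with BLMW's bound `dim T₀(λ) ≤ g(λ, m×δ, m×δ)`,
  `ValuativeFlip.stub_truncT0_le_kronecker`), hence refutes the Kronecker flip of route GCTMult
  (`not_gctKroneckerFlip_of_noValuativeFlip`, stmt-ValiantsHypothesis-0888: the window with
  constant `c₀ + 2` contains the padding `m = n ^ (c₀ + 1)`) as well as this route's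
  `ValuativeFlip` (first seat, `not_valuativeFlip_of_noValuativeFlip`). In the chain
  `GctNoMultBarrier (0890) ⇒ NoValuativeFlip (12629) ⇒ [no Kronecker flip at polynomial padding]`
  every statement is open (Bläser–Ikenmeyer 2025 §12.4; Ikenmeyer–Panova 2017 is positivity of
  `g`, i.e. occurrence-level, only).

Sources: P. Bürgisser, C. Ikenmeyer, G. Panova, J. AMS 32 (2019) Thm. 1.4 (arXiv:1604.06431);
BLMW, SIAM J. Comput. 40 (2011) §5.2 Prop. 5.2.1 (arXiv:0907.2850); C. Ikenmeyer, G. Panova,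
Adv. Math. 319 (2017) (arXiv:1512.03798); M. Bläser, C. Ikenmeyer, Theory of Computing Graduate
Surveys 10 (2025) §12.4 (doi:10.4086/toc.gs.2025.010).
-/

-- `Summit.ValiantsHypothesis.ValiantsHypothesis.…` repeats a component by the D-0017 layout
-- (single-conjunct summit), which the `dupNamespace` linter flags; the name is mandated.
set_option linter.dupNamespace false

namespace Summit.ValiantsHypothesis.ValiantsHypothesis.Theorems.NoValuativeFlip

open Literature.NumberTheory.DiophantineGeometry Literature.Computability.AlgebraicComplexity
open Literature.Computability.Complexity
open Summit.ValiantsHypothesis.ValiantsHypothesis.Theses.ValuativeGCT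
open Summit.ValiantsHypothesis.ValiantsHypothesis.Theorems.ValuativeBound
open Summit.ValiantsHypothesis.ValiantsHypothesis.Theorems.ValuativeFlip

/-! ## §1 The occurrence shadow of the item is a theorem -/

/-- **Occurrence transfer in multiplicity currency** (BIP 2019 Thm. 1.4, fresh padding, as
discharged in the tree): for `0 < n` and `n ^ 25 ≤ m`, a weight `χ` with POSITIVE multiplicity in
`ℂ[Δ(X₀₀^(m-n) per_n)]` has positive multiplicity `K_m(χ)` in `ℂ[Δ(det_m)]`. Positivity of the
`finrank` forces the highest-weight space of the padded permanent to be nonzero (occurrence);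
`no_occurrence_obstructions_holds` transports occurrence to the determinant; there the
highest-weight space is finite-dimensional (`finiteDimensional_highestWeightSpace_orbitCoordRep_holds`,
a weight pins the degree, `m ≠ 0`), so occurrence is positivity of `K_m(χ)`.
[Bürgisser–Ikenmeyer–Panova 2019, Thm. 1.4] -/
theorem orbitMultiplicity_det_pos_of_paddedPer_pos {n m : ℕ} [NeZero m] (hn : 0 < n)
    (hnm : n ^ 25 ≤ m) (χ : Weight (MatIdx m))
    (h : 0 < orbitMultiplicity ℂ (paddedPerFormLex ℂ n m) m χ) :
    0 < orbitMultiplicity ℂ (detFormLex ℂ m) m χ := by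
  have hpp : HasHighestWeight (paddedPerOrbitRep ℂ n m) χ := by
    intro hbot
    have h0 : orbitMultiplicity ℂ (paddedPerFormLex ℂ n m) m χ = 0 := by
      rw [orbitMultiplicity, hwMultiplicity]
      change Module.finrank ℂ
        ↥(highestWeightSpace (paddedPerOrbitRep ℂ n m) χ) = 0
      rw [hbot, finrank_bot]
    omega
  have hdet : HasHighestWeight (detOrbitRep ℂ m) χ := no_occurrence_obstructions_holds n m hn hnm χ hpp
  haveI : FiniteDimensional ℂ (highestWeightSpace (orbitCoordRep (detFormLex ℂ m) m) χ) :=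
    finiteDimensional_highestWeightSpace_orbitCoordRep_holds (detFormLex ℂ m) (NeZero.ne m) χ
  rw [orbitMultiplicity, hwMultiplicity]
  refine Nat.pos_of_ne_zero fun h0 => hdet ?_
  change highestWeightSpace (orbitCoordRep (detFormLex ℂ m) m) χ = ⊥
  exact Submodule.finrank_eq_zero.mp h0

/-- **The occurrence shadow of `NoValuativeFlip`, body form.** For `0 < n`, `n ^ 25 ≤ m` and
every centre `(U, r)`, degree `δ` and `λ ⊢ mδ` with at most `m²` parts: if `λ*` occurs in
`ℂ[Δ(X₀₀^(m-n) per_n)]` then the valuative truncation `T_U(λ)` is nonzero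
(`0 < mult_pp(λ*) → 0 < dim T_U(λ)`): `0 < K_m(λ*)` by `orbitMultiplicity_det_pos_of_paddedPer_pos`
and `K_m(λ*) ≤ dim T_U(λ)` by the route's valuative bound `ValuativeBound_proof` (stmt-12625).
Hence a valuative flip `dim T_U(λ) < mult_pp(λ*)` at such a padding is a proper multiplicity
comparison, never a vanishing of the truncation. [Bürgisser–Ikenmeyer–Panova 2019, Thm. 1.4;
this route, ValuativeBound] -/
theorem finrank_truncation_pos_of_orbitMultiplicity_paddedPer_pos {n : ℕ} (m : ℕ) [NeZero m]
    (hn : 0 < n) (hnm : n ^ 25 ≤ m)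
    (U : Submodule ℂ (Literature.NumberTheory.DiophantineGeometry.MatIdx m → ℂ)) (r : ℕ)
    (hU : ∀ u ∈ U, (Matrix.of fun a b : Fin m => u (toLex (a, b))).rank ≤ r)
    (δ : ℕ) (lam : Nat.Partition (m * δ)) (hcard : lam.parts.card ≤ m * m) :
    let χ : Literature.NumberTheory.DiophantineGeometry.Weight (Literature.NumberTheory.DiophantineGeometry.MatIdx m) := (Literature.NumberTheory.DiophantineGeometry.Weight.dualOfPartition (m * m) lam).toMatIdx; let T : Submodule ℂ (MvPolynomial (Literature.NumberTheory.DiophantineGeometry.MatIdx m × Literature.NumberTheory.DiophantineGeometry.MatIdx m) ℂ) := MvPolynomial.homogeneousSubmodule (Literature.NumberTheory.DiophantineGeometry.MatIdx m × Literature.NumberTheory.DiophantineGeometry.MatIdx m) ℂ (m * δ) ⊓ ((MvPolynomial.vanishingIdeal ℂ {p : Literature.NumberTheory.DiophantineGeometry.MatIdx m × Literature.NumberTheory.DiophantineGeometry.MatIdx m → ℂ | ∀ j : Literature.NumberTheory.DiophantineGeometry.MatIdx m, (fun i => p (j, i)) ∈ U}) ^ (δ * (m - r))).restrictScalars ℂ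 ⊓ (⨅ (M : Matrix (Literature.NumberTheory.DiophantineGeometry.MatIdx m) (Literature.NumberTheory.DiophantineGeometry.MatIdx m) ℂ) (_ : Literature.Computability.AlgebraicComplexity.linSubst (Literature.NumberTheory.DiophantineGeometry.MatIdx m) ℂ M (Literature.NumberTheory.DiophantineGeometry.detFormLex ℂ m) = Literature.NumberTheory.DiophantineGeometry.detFormLex ℂ m), LinearMap.ker ((MvPolynomial.aeval (R := ℂ) fun p : Literature.NumberTheory.DiophantineGeometry.MatIdx m × Literature.NumberTheory.DiophantineGeometry.MatIdx m => ∑ l : Literature.NumberTheory.DiophantineGeometry.MatIdx m, M l p.2 • MvPolynomial.X (p.1, l)).toLinearMap - LinearMap.id (R := ℂ) (M := MvPolynomial (Literature.NumberTheory.DiophantineGeometry.MatIdx m × Literature.NumberTheory.DiophantineGeometry.MatIdx m) ℂ))) ⊓ (⨅ (g : Matrix.GeneralLinearGroup (Literature.NumberTheory.DiophantineGeometry.MatIdx m) ℂ) (_ : Literature.NumberTheory.DiophantineGeometry.IsUpperTriangular g), LinearMap.ker ((MvPolynomial.aeval (R := ℂ) fun p : Literature.NumberTheory.DiophantineGeometry.MatIdx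 m × Literature.NumberTheory.DiophantineGeometry.MatIdx m => ∑ l : Literature.NumberTheory.DiophantineGeometry.MatIdx m, ((g⁻¹ : Matrix.GeneralLinearGroup (Literature.NumberTheory.DiophantineGeometry.MatIdx m) ℂ) : Matrix (Literature.NumberTheory.DiophantineGeometry.MatIdx m) (Literature.NumberTheory.DiophantineGeometry.MatIdx m) ℂ) p.1 l • MvPolynomial.X (l, p.2)).toLinearMap - Literature.NumberTheory.DiophantineGeometry.weightChar χ g • LinearMap.id (R := ℂ) (M := MvPolynomial (Literature.NumberTheory.DiophantineGeometry.MatIdx m × Literature.NumberTheory.DiophantineGeometry.MatIdx m) ℂ))); 0 < Literature.NumberTheory.DiophantineGeometry.orbitMultiplicity ℂ (Literature.NumberTheory.DiophantineGeometry.paddedPerFormLex ℂ n m) m χ → 0 < Module.finrank ℂ ↥T := by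
  intro χ T hpos
  exact lt_of_lt_of_le (orbitMultiplicity_det_pos_of_paddedPer_pos hn hnm χ hpos)
    (ValuativeBound_proof m U r hU δ lam hcard)

/-- **The occurrence shadow of `NoValuativeFlip` holds** (exponent `c₀ = 25`, threshold
`n₀ = 1`; the item's quantifier prefix verbatim, its conclusion weakened from
`mult_pp(λ*) ≤ dim T_U(λ)` to `0 < mult_pp(λ*) → 0 < dim T_U(λ)`): from the padding `m ≥ n ^ 25`
on, no valuative truncation vanishes at a weight occurring in the padded permanent's coordinate
ring — the valuative analogue of "no occurrence obstructions" is a theorem, so the open content of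
the item is purely a comparison of two positive multiplicities.
[Bürgisser–Ikenmeyer–Panova 2019, Thm. 1.4; this route, ValuativeBound] -/
theorem noValuativeFlip_occurrenceShadow :
    ∃ c₀ n₀ : ℕ, ∀ n ≥ n₀, ∀ (m : ℕ) [NeZero m], n ^ c₀ ≤ m → ∀ (U : Submodule ℂ (Literature.NumberTheory.DiophantineGeometry.MatIdx m → ℂ)) (r : ℕ), (∀ u ∈ U, (Matrix.of fun a b : Fin m => u (toLex (a, b))).rank ≤ r) → ∀ (δ : ℕ) (lam : Nat.Partition (m * δ)), lam.parts.card ≤ m * m → let χ : Literature.NumberTheory.DiophantineGeometry.Weight (Literature.NumberTheory.DiophantineGeometry.MatIdx m) := (Literature.NumberTheory.DiophantineGeometry.Weight.dualOfPartition (m * m) lam).toMatIdx; let T : Submodule ℂ (MvPolynomial (Literature.NumberTheory.DiophantineGeometry.MatIdx m × Literature.NumberTheory.DiophantineGeometry.MatIdx m) ℂ) := MvPolynomial.homogeneousSubmodule (Literature.NumberTheory.DiophantineGeometry.MatIdx m × Literature.NumberTheory.DiophantineGeometry.MatIdx m) ℂ (m * δ) ⊓ ((MvPolynomial.vanishingIdeal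 ℂ {p : Literature.NumberTheory.DiophantineGeometry.MatIdx m × Literature.NumberTheory.DiophantineGeometry.MatIdx m → ℂ | ∀ j : Literature.NumberTheory.DiophantineGeometry.MatIdx m, (fun i => p (j, i)) ∈ U}) ^ (δ * (m - r))).restrictScalars ℂ ⊓ (⨅ (M : Matrix (Literature.NumberTheory.DiophantineGeometry.MatIdx m) (Literature.NumberTheory.DiophantineGeometry.MatIdx m) ℂ) (_ : Literature.Computability.AlgebraicComplexity.linSubst (Literature.NumberTheory.DiophantineGeometry.MatIdx m) ℂ M (Literature.NumberTheory.DiophantineGeometry.detFormLex ℂ m) = Literature.NumberTheory.DiophantineGeometry.detFormLex ℂ m), LinearMap.ker ((MvPolynomial.aeval (R := ℂ) fun p : Literature.NumberTheory.DiophantineGeometry.MatIdx m × Literature.NumberTheory.DiophantineGeometry.MatIdx m => ∑ l : Literature.NumberTheory.DiophantineGeometry.MatIdx m, M l p.2 • MvPolynomial.X (p.1, l)).toLinearMap - LinearMap.id (R := ℂ) (M := MvPolynomial (Literature.NumberTheory.DiophantineGeometry.MatIdx m × Literature.NumberTheory.DiophantineGeometry.MatIdx m) ℂ))) ⊓ (⨅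 (g : Matrix.GeneralLinearGroup (Literature.NumberTheory.DiophantineGeometry.MatIdx m) ℂ) (_ : Literature.NumberTheory.DiophantineGeometry.IsUpperTriangular g), LinearMap.ker ((MvPolynomial.aeval (R := ℂ) fun p : Literature.NumberTheory.DiophantineGeometry.MatIdx m × Literature.NumberTheory.DiophantineGeometry.MatIdx m => ∑ l : Literature.NumberTheory.DiophantineGeometry.MatIdx m, ((g⁻¹ : Matrix.GeneralLinearGroup (Literature.NumberTheory.DiophantineGeometry.MatIdx m) ℂ) : Matrix (Literature.NumberTheory.DiophantineGeometry.MatIdx m) (Literature.NumberTheory.DiophantineGeometry.MatIdx m) ℂ) p.1 l • MvPolynomial.X (l, p.2)).toLinearMap - Literature.NumberTheory.DiophantineGeometry.weightChar χ g • LinearMap.id (R := ℂ) (M := MvPolynomial (Literature.NumberTheory.DiophantineGeometry.MatIdx m × Literature.NumberTheory.DiophantineGeometry.MatIdx m) ℂ))); 0 < Literature.NumberTheory.DiophantineGeometry.orbitMultiplicity ℂ (Literature.NumberTheory.DiophantineGeometry.paddedPerFormLex ℂ n m) m χ → 0 < Module.finrank ℂ ↥T := by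
  refine ⟨25, 1, fun n hn m _ hm U r hU δ lam hcard => ?_⟩
  exact finrank_truncation_pos_of_orbitMultiplicity_paddedPer_pos m hn hm U r hU δ lam hcard

/-- **`NoValuativeFlip` is its restriction to the common support.** The item is equivalent to
the same statement asked only at weights `λ*` that occur in `ℂ[Δ(det_m)]` (`0 < K_m(λ*)`; by §1
these contain, from `m ≥ n ^ 25` on, all weights occurring in `ℂ[Δ(X₀₀^(m-n) per_n)]`): `→`
forgets the hypothesis; `←` replaces `(c₀, n₀)` by `(max c₀ 25, max n₀ 1)` and, at a weight with
`mult_pp(λ*) = 0`, has nothing to show, while at a weight with `0 < mult_pp(λ*)` the occurrence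
transfer `orbitMultiplicity_det_pos_of_paddedPer_pos` supplies `0 < K_m(λ*)`.
[Bürgisser–Ikenmeyer–Panova 2019, Thm. 1.4; this file] -/
theorem noValuativeFlip_iff_onCommonSupport :
    NoValuativeFlip ↔
    ∃ c₀ n₀ : ℕ, ∀ n ≥ n₀, ∀ (m : ℕ) [NeZero m], n ^ c₀ ≤ m → ∀ (U : Submodule ℂ (Literature.NumberTheory.DiophantineGeometry.MatIdx m → ℂ)) (r : ℕ), (∀ u ∈ U, (Matrix.of fun a b : Fin m => u (toLex (a, b))).rank ≤ r) → ∀ (δ : ℕ) (lam : Nat.Partition (m * δ)), lam.parts.card ≤ m * m → let χ : Literature.NumberTheory.DiophantineGeometry.Weight (Literature.NumberTheory.DiophantineGeometry.MatIdx m) := (Literature.NumberTheory.DiophantineGeometry.Weight.dualOfPartition (m * m) lam).toMatIdx; let T : Submodule ℂ (MvPolynomial (Literature.NumberTheory.DiophantineGeometry.MatIdx m × Literature.NumberTheory.DiophantineGeometry.MatIdx m) ℂ) := MvPolynomial.homogeneousSubmodule (Literature.NumberTheory.DiophantineGeometry.MatIdx m × Literature.NumberTheory.DiophantineGeometry.MatIdx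 m) ℂ (m * δ) ⊓ ((MvPolynomial.vanishingIdeal ℂ {p : Literature.NumberTheory.DiophantineGeometry.MatIdx m × Literature.NumberTheory.DiophantineGeometry.MatIdx m → ℂ | ∀ j : Literature.NumberTheory.DiophantineGeometry.MatIdx m, (fun i => p (j, i)) ∈ U}) ^ (δ * (m - r))).restrictScalars ℂ ⊓ (⨅ (M : Matrix (Literature.NumberTheory.DiophantineGeometry.MatIdx m) (Literature.NumberTheory.DiophantineGeometry.MatIdx m) ℂ) (_ : Literature.Computability.AlgebraicComplexity.linSubst (Literature.NumberTheory.DiophantineGeometry.MatIdx m) ℂ M (Literature.NumberTheory.DiophantineGeometry.detFormLex ℂ m) = Literature.NumberTheory.DiophantineGeometry.detFormLex ℂ m), LinearMap.ker ((MvPolynomial.aeval (R := ℂ) fun p : Literature.NumberTheory.DiophantineGeometry.MatIdx m × Literature.NumberTheory.DiophantineGeometry.MatIdx m => ∑ l : Literature.NumberTheory.DiophantineGeometry.MatIdx m, M l p.2 • MvPolynomial.X (p.1, l)).toLinearMap - LinearMap.id (R := ℂ) (M := MvPolynomial (Literature.NumberTheory.DiophantineGeometry.MatIdx m × Literature.NumberTheory.DiophantineGeometry.MatIdx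 m) ℂ))) ⊓ (⨅ (g : Matrix.GeneralLinearGroup (Literature.NumberTheory.DiophantineGeometry.MatIdx m) ℂ) (_ : Literature.NumberTheory.DiophantineGeometry.IsUpperTriangular g), LinearMap.ker ((MvPolynomial.aeval (R := ℂ) fun p : Literature.NumberTheory.DiophantineGeometry.MatIdx m × Literature.NumberTheory.DiophantineGeometry.MatIdx m => ∑ l : Literature.NumberTheory.DiophantineGeometry.MatIdx m, ((g⁻¹ : Matrix.GeneralLinearGroup (Literature.NumberTheory.DiophantineGeometry.MatIdx m) ℂ) : Matrix (Literature.NumberTheory.DiophantineGeometry.MatIdx m) (Literature.NumberTheory.DiophantineGeometry.MatIdx m) ℂ) p.1 l • MvPolynomial.X (l, p.2)).toLinearMap - Literature.NumberTheory.DiophantineGeometry.weightChar χ g • LinearMap.id (R := ℂ) (M := MvPolynomial (Literature.NumberTheory.DiophantineGeometry.MatIdx m × Literature.NumberTheory.DiophantineGeometry.MatIdx m) ℂ))); 0 < Literature.NumberTheory.DiophantineGeometry.orbitMultiplicity ℂ (Literature.NumberTheory.DiophantineGeometry.detFormLex ℂ m) m χ → Literature.NumberTheory.DiophantineGeometry.orbitMultiplicity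 ℂ (Literature.NumberTheory.DiophantineGeometry.paddedPerFormLex ℂ n m) m χ ≤ Module.finrank ℂ ↥T := by
  constructor
  · rintro ⟨c₀, n₀, h⟩
    refine ⟨c₀, n₀, fun n hn m _ hm U r hU δ lam hcard => ?_⟩
    intro χ T _
    exact h n hn m hm U r hU δ lam hcard
  · rintro ⟨c₀, n₀, h⟩
    refine ⟨max c₀ 25, max n₀ 1, fun n hn m _ hm U r hU δ lam hcard => ?_⟩
    intro χ T
    have hn₀ : n₀ ≤ n := le_trans (le_max_left _ _) hn
    have hn1 : 1 ≤ n := le_trans (le_max_right _ _) hn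
    have hm₀ : n ^ c₀ ≤ m := le_trans (Nat.pow_le_pow_right hn1 (le_max_left _ _)) hm
    have hm25 : n ^ 25 ≤ m := le_trans (Nat.pow_le_pow_right hn1 (le_max_right _ _)) hm
    rcases Nat.eq_zero_or_pos (Literature.NumberTheory.DiophantineGeometry.orbitMultiplicity ℂ (Literature.NumberTheory.DiophantineGeometry.paddedPerFormLex ℂ n m) m χ) with h0 | hpos
    · rw [h0]
      exact Nat.zero_le _
    · exact h n hn₀ m hm₀ U r hU δ lam hcard
        (orbitMultiplicity_det_pos_of_paddedPer_pos hn1 hm25 χ hpos)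

/-! ## §2 The Kronecker shadow -/

/-- **`NoValuativeFlip` bounds the padded permanent's multiplicities by rectangular Kronecker
coefficients beyond some polynomial padding**: if the item holds with `(c₀, n₀)` then for
`n ≥ n₀`, `m ≥ n ^ c₀` and every `λ ⊢ mδ` with at most `m²` parts,
`mult_λ* ℂ[Δ(X₀₀^(m-n) per_n)] ≤ g(λ, m×δ, m×δ)`. The `U`-free consequence of the item
(`orbitMultiplicity_paddedPer_le_finrank_untruncated_of_noValuativeFlip`: at the centre `U = ⊤`,
`r = m` the valuative factor is `P^0 = ⊤`, leaving the space `T₀(λ)` of `Stab(det_m)`-invariant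
highest-weight vectors of weight `λ*` in degree `mδ`) composed with BLMW's bound
`dim T₀(λ) ≤ g(λ, m×δ, m×δ)` (`ValuativeFlip.stub_truncT0_le_kronecker`, SIAM J. Comput. 40
(2011) Prop. 5.2.1 run on `ℂ[End W]`). Whether this Kronecker comparison holds at polynomial
padding is itself open (Ikenmeyer–Panova 2017 prove positivity of `g` on the relevant shapes,
an occurrence-level statement). [BLMW 2011 §5.2 Prop. 5.2.1; this route] -/
theorem orbitMultiplicity_paddedPer_le_kroneckerCoeff_of_noValuativeFlip (h : NoValuativeFlip) :
    ∃ c₀ n₀ : ℕ, ∀ n ≥ n₀, ∀ (m : ℕ) [NeZero m], n ^ c₀ ≤ m →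
      ∀ (δ : ℕ) (lam : Nat.Partition (m * δ)), lam.parts.card ≤ m * m →
        orbitMultiplicity ℂ (paddedPerFormLex ℂ n m) m
            ((Weight.dualOfPartition (m * m) lam).toMatIdx : Weight (MatIdx m)) ≤
          kroneckerCoeff ℂ lam (Nat.Partition.rectangle m δ) (Nat.Partition.rectangle m δ) := by
  obtain ⟨c₀, n₀, hS⟩ := orbitMultiplicity_paddedPer_le_finrank_untruncated_of_noValuativeFlip h
  refine ⟨c₀, n₀, fun n hn m _ hm δ lam hcard => ?_⟩
  have key := hS n hn m hm δ lam hcard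
  dsimp only at key
  exact key.trans (stub_truncT0_le_kronecker m δ lam hcard)

/-- **`NoValuativeFlip` refutes the Kronecker flip of route GCTMult** (stmt-ValiantsHypothesis-0888,
`GCTMult.GctKroneckerFlip`: for every window constant `c`, eventually in `n`, at every
`n ≤ m ≤ 2 ^ ((log₂ n + c) ^ c)` some `λ ⊢ m d` with at most `m²` parts has
`g(λ, m×d, m×d) < mult_λ* ℂ[Δ(X₀₀^(m-n) per_n)]`). Given the exponent `c₀` and threshold `n₀` of
the Kronecker shadow (`orbitMultiplicity_paddedPer_le_kroneckerCoeff_of_noValuativeFlip`), run the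
flip with `c = c₀ + 2` (threshold `n₁`); at `n = max (max n₀ n₁) 2` the padding `m = n ^ (c₀ + 1)`
lies in the window (`pow_succ_le_two_pow_log_add_pow`) and beyond `n ^ c₀`, so the flip's `λ`
contradicts the shadow. So the item is a common kill statement for this route's `ValuativeFlip`
(stmt-12624, first seat) and for stmt-0888. [this route; BLMW 2011 §5.2 Prop. 5.2.1] -/
theorem not_gctKroneckerFlip_of_noValuativeFlip (h : NoValuativeFlip) :
    ¬ Summit.ValiantsHypothesis.ValiantsHypothesis.Theses.GCTMult.GctKroneckerFlip := by
  intro hK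
  obtain ⟨c₀, n₀, hS⟩ := orbitMultiplicity_paddedPer_le_kroneckerCoeff_of_noValuativeFlip h
  obtain ⟨n₁, hn₁⟩ := hK (c₀ + 2)
  set n : ℕ := max (max n₀ n₁) 2 with hn
  have hn0 : n₀ ≤ n := (le_max_left _ _).trans (le_max_left _ _)
  have hn1 : n₁ ≤ n := (le_max_right _ _).trans (le_max_left _ _)
  have hn2 : 2 ≤ n := le_max_right _ _
  haveI : NeZero (n ^ (c₀ + 1)) := ⟨(pow_pos (by omega : 0 < n) _).ne'⟩
  have hnm : n ≤ n ^ (c₀ + 1) := le_self_pow₀ (by omega) (Nat.succ_ne_zero c₀)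
  have hwin : n ^ (c₀ + 1) ≤ 2 ^ ((Nat.log 2 n + (c₀ + 2)) ^ (c₀ + 2)) :=
    pow_succ_le_two_pow_log_add_pow n c₀
  have hpad : n ^ c₀ ≤ n ^ (c₀ + 1) := Nat.pow_le_pow_right (by omega) (Nat.le_succ c₀)
  obtain ⟨d, lam, hcard, hlt⟩ := hn₁ n hn1 (n ^ (c₀ + 1)) hnm hwin
  exact (not_le.mpr hlt) (hS n hn0 (n ^ (c₀ + 1)) hpad d lam hcard)

end Summit.ValiantsHypothesis.ValiantsHypothesis.Theorems.NoValuativeFlip
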